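import Mathlib
import HarnessLib
import Summits.AnomalousDissipation.AnomalousDissipation.Theses.LimitingAbsorption
import Literature.Analysis.FluidPDE.SeisDissipationRateBound

/-!
# Sketch (crux-ideate, ideator 2, round 1) — crux `LimitingAbsorption.RelaxingFamily`
  (stmt-AnomalousDissipation-15009): first-lemma signatures for the idea card
  `ergodic-sup-phase-collapse` and the obstruction-side typed target `collinear_noGo`.

Nothing here is an item; everything elaborates (`lean check` rc 0, no `sorry`).
Conventions: `𝕋²` the unit flat 2-torus, `E²` planar vectors; (U_h)-type decay clauses are
written exactly as in the route decl `RelaxingFamily` (weak scalar solutions on `[0,T)`, a.e. `t`).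
-/

noncomputable section

open MeasureTheory Set Filter Topology Function

namespace Summit.AnomalousDissipation.AnomalousDissipation.Cruxes.RelaxingFamily.SketchIdeator2

set_option linter.dupNamespace false

open Literature.Analysis.FunctionSpaces Literature.Analysis.FunctionSpaces.Torus
open Literature.Analysis.FluidPDE Literature.Analysis.FluidPDE.Torus
open Summit.AnomalousDissipation.AnomalousDissipation.Theses.LimitingAbsorption

/-- The unit flat 2-torus (local notation). -/
local notation "𝕋²" => UnitAddTorus (Fin 2)
/-- Planar vectors (local notation). -/
local notation "E²" => EuclideanSpace ℝ (Fin 2)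

/-! ### 1. The decay clause of the crux, with the phase set as a parameter -/

/-- `DecayClause κ u h C γ S`: from every phase `s ∈ S`, every weak solution of
`∂ₜθ + u(s+·)·∇θ = κΔθ`, `θ(0) = h` on `[0,T)` obeys `‖θ(t)‖² ≤ C e^{-γt} ‖h‖²` for a.e.
`t ∈ (0,T)`. With `S = Ici 0` this is literally the last conjunct of `RelaxingFamily`. -/
def DecayClause (κ : ℝ) (u : ℝ → 𝕋² → E²) (h : 𝕋² → ℝ) (C γ : ℝ) (S : Set ℝ) : Prop :=
  ∀ s ∈ S, ∀ (T : ℝ) (θ : ℝ → 𝕋² → ℝ),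
    IsWeakScalarTransportOn T κ (fun t => u (s + t)) h θ →
      ∀ᵐ t ∂(volume.restrict (Ioo (0 : ℝ) T)),
        scalarL2Sq (θ t) ≤ C * Real.exp (-(γ * t)) * scalarL2Sq h

/-- Standing side conditions on one planar Leray–Hopf trajectory at viscosity `κ` with steady force
`g`: global LH from its own initial slice, locally bounded on every `(0,T)`, mean energy `≤ E`. -/
def AdmissibleTrajectory (κ E : ℝ) (g : 𝕋² → E²) (v : ℝ → 𝕋² → E²) : Prop :=
  IsGlobalLerayHopf κ (fun _ => g) (v 0) v ∧
  (∀ T : ℝ, 0 < T → MemLp (stLift v) ⊤ (volume.restrict (Ioo (0 : ℝ) T ×ˢ univ))) ∧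
  meanEnergy v ≤ E

/-! ### 2. HULL FORM of phase-uniformity (the reformulation behind the card)

`∀ s ≥ 0` along ONE trajectory is the same as `phase 0` over a SHIFT-INVARIANT FAMILY of
trajectories (its hull; for a witness living on a compact invariant set `K_j` of the NS semiflow,
the family of all trajectories through `K_j`). -/

/-- C⁺ (hull form): for each level `j` a nonempty, forward-shift-invariant family `𝒱 j` of
admissible trajectories, on which the decay clause holds FROM PHASE 0 with one `(C, γ)`. -/
def HullRelaxingFamily : Prop :=
  ∃ (g : 𝕋² → E²) (h : 𝕋² → ℝ), IsSmooth g ∧ IsDivFree g ∧ HasZeroMean g ∧ IsSmooth h ∧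
    HasZeroMean h ∧ h ≠ 0 ∧
    ∃ (ν : ℕ → ℝ) (𝒱 : ℕ → Set (ℝ → 𝕋² → E²)) (E C γ : ℝ),
      (∀ j, 0 < ν j) ∧ Tendsto ν atTop (𝓝 0) ∧ 0 ≤ C ∧ 0 < γ ∧
      (∀ j, (𝒱 j).Nonempty) ∧
      (∀ j, ∀ v ∈ 𝒱 j, ∀ s : ℝ, 0 ≤ s → (fun t => v (s + t)) ∈ 𝒱 j) ∧
      (∀ j, ∀ v ∈ 𝒱 j, AdmissibleTrajectory (ν j) E g v) ∧
      (∀ j, ∀ v ∈ 𝒱 j, DecayClause (ν j) v h C γ {0})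

/-- FIRST LEMMA (a), provable now (size S): the hull form implies the crux verbatim — pick any
`v_j ∈ 𝒱 j`, datum `v_j 0`; the phase-`s` clause for `v_j` is the phase-`0` clause for the shifted
trajectory, which lies in `𝒱 j`. -/
def hull_imp_relaxingFamily : Prop := HullRelaxingFamily → RelaxingFamily

/-- FIRST LEMMA (b), provable now (size S; = `periodicPhaseReduction` of the sister-crux sketch
`Cruxes/UniformRelaxationWitness/SketchIdeator2.lean`, restated for this crux): for a time-periodic
stirring field the phase set collapses to one period. -/
def periodicPhaseCollapse : Prop :=
  ∀ (κ τ C γ : ℝ) (u : ℝ → 𝕋² → E²) (h : 𝕋² → ℝ), 0 < τ → (∀ t, u (t + τ) = u t) →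
    DecayClause κ u h C γ (Ico 0 τ) → DecayClause κ u h C γ (Ici 0)

/-- PROOF of first lemma (a): the hull form implies `RelaxingFamily`. -/
theorem hull_imp_relaxingFamily_holds : hull_imp_relaxingFamily := by
  rintro ⟨g, h, hg, hgd, hgm, hh, hhm, hh0, ν, 𝒱, E, C, γ, hν, hνlim, hC, hγ, hne, hshift, hadm,
    hdec⟩
  choose v hv using hne
  refine ⟨g, h, hg, hgd, hgm, hh, hhm, hh0, ν, fun j => v j 0, v, hν, hνlim,
    fun j => (hadm j (v j) (hv j)).1, fun j => (hadm j (v j) (hv j)).2.1,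
    ⟨E, fun j => (hadm j (v j) (hv j)).2.2⟩, C, γ, hC, hγ, ?_⟩
  intro j s hs T θ hθ
  have hw : (fun t => v j (s + t)) ∈ 𝒱 j := hshift j (v j) (hv j) s hs
  have key := hdec j _ hw 0 (Set.mem_singleton 0) T θ
  have heq : (fun t => (fun t => v j (s + t)) (0 + t)) = fun t => v j (s + t) := by
    funext t; simp
  rw [heq] at key
  exact key hθ

/-- Iterated periodicity. -/
theorem periodic_nat_mul {u : ℝ → 𝕋² → E²} {τ : ℝ} (hper : ∀ t, u (t + τ) = u t) :
    ∀ (n : ℕ) (t : ℝ), u (t + n * τ) = u t := by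
  intro n
  induction n with
  | zero => intro t; simp
  | succ k ih =>
    intro t
    have : t + (↑(k + 1) : ℝ) * τ = (t + k * τ) + τ := by push_cast; ring
    rw [this, hper, ih]

/-- PROOF of first lemma (b): periodic phase collapse. -/
theorem periodicPhaseCollapse_holds : periodicPhaseCollapse := by
  intro κ τ C γ u h hτ hper hdec s hs T θ hθ
  -- reduce the phase modulo the period
  set n : ℕ := ⌊s / τ⌋₊ with hn
  set s' : ℝ := s - n * τ with hs'
  have hfloor_le : (n : ℝ) ≤ s / τ := Nat.floor_le (div_nonneg hs hτ.le)
  have hlt_floor : s / τ < n + 1 := Nat.lt_floor_add_one (s / τ)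
  have hs'0 : 0 ≤ s' := by
    have : (n : ℝ) * τ ≤ s := by
      have := mul_le_mul_of_nonneg_right hfloor_le hτ.le
      rwa [div_mul_cancel₀ s hτ.ne'] at this
    simp only [hs']; linarith
  have hs'τ : s' < τ := by
    have : s < (n + 1) * τ := by
      have := (div_lt_iff₀ hτ).1 hlt_floor
      linarith
    simp only [hs']; nlinarith
  have hmem : s' ∈ Ico 0 τ := ⟨hs'0, hs'τ⟩
  have heq : (fun t => u (s + t)) = fun t => u (s' + t) := by
    funext t
    have h1 : s + t = (s' + t) + n * τ := by simp only [hs']; ring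
    rw [h1, periodic_nat_mul hper n]
  have key := hdec s' hmem T θ
  rw [← heq] at key
  exact key hθ

/-! ### 3. The lever: SEMI-UNIFORM SUBADDITIVE ERGODIC BOUND (Schreiber 1998, Thm 1;
Sturman–Stark 2000) — uniform-in-base-point growth of a continuous subadditive cocycle over a
compact system is governed by the worst invariant measure. Applied per level `j` with
`X = K_j` (compact invariant set of the planar NS time-`τ` map), `f n v = log ‖P_v(nτ,0)|odd‖`
(odd-sector scalar propagator along the trajectory from `v`; subadditive by the cocycle property,
continuous at fixed `ν_j > 0`), it turns "decay from EVERY phase with uniform constants" into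
"every ergodic measure on `K_j` has odd-sector exponent `< -γ`". Named fact, unproved here. -/
def SemiUniformSubadditiveBound : Prop :=
  ∀ (X : Type) [MetricSpace X] [CompactSpace X] [MeasurableSpace X] [BorelSpace X]
    (T : X → X) (_hT : Continuous T) (f : ℕ → X → ℝ) (_hf : ∀ n, Continuous (f n))
    (_hsub : ∀ n m x, f (n + m) x ≤ f n x + f m (T^[n] x)) (Λ : ℝ),
    (∀ μ : Measure X, IsProbabilityMeasure μ → MeasurePreserving T μ μ →
        ∃ n : ℕ, 0 < n ∧ ∫ x, f n x ∂μ ≤ n * Λ) →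
    ∀ ε : ℝ, 0 < ε → ∃ N : ℕ, ∀ n, N ≤ n → ∀ x, f n x ≤ n * (Λ + ε)

/-! ### 4. The rigorous discriminator every witness set must pass: SEIS' ENSTROPHY FLOOR in the
crux's own normalisation (time-rescaled corollary of the vendored `Seis2022_rmk1_L2`). -/

/-- For the fixed profile `h` and decay constants `(C, γ)`: there are `κ₀, K` (depending only on
`h, C`) such that any bounded stirring field with windowed enstrophy budget
`∫₀ᵗ ‖∇u‖₂ ≤ M (1 + t)` (`M ≥ 1`) that relaxes `h` like `C e^{-γt}` from phase `0` at diffusivity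
`κ ≤ κ₀` obeys `γ · log(M/κ) ≤ 2 K M` — i.e. period/time-mean enstrophy^{1/2} `≳ (γ/2K) log(1/κ)`. -/
def SeisEnstrophyFloor : Prop :=
  ∀ (C γ : ℝ) (h : 𝕋² → ℝ), 0 ≤ C → 0 < γ → IsSmooth h → HasZeroMean h → h ≠ 0 →
    ∃ κ₀ K : ℝ, 0 < κ₀ ∧ κ₀ < 1 ∧ 0 ≤ K ∧
      ∀ (κ M : ℝ) (u : ℝ → 𝕋² → E²), 0 < κ → κ ≤ κ₀ → 1 ≤ M →
        (∃ M' : NNReal, ∀ᵐ t ∂(volume.restrict (Ioi (0 : ℝ))), ∫⁻ x, ‖u t x‖ₑ ^ 2 ≤ M') →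
        (∀ t : ℝ, 0 < t →
            ∫⁻ s in Ioo 0 t, eGradNormSq (u s) ^ (1 / 2 : ℝ) ≤ ENNReal.ofReal (M * (1 + t))) →
        (∃ θ : ℝ → 𝕋² → ℝ, ∀ T : ℝ, 0 < T → IsWeakScalarTransportOn T κ u h θ) →
        (∀ θ : ℝ → 𝕋² → ℝ, (∀ T : ℝ, 0 < T → IsWeakScalarTransportOn T κ u h θ) →
            ∀ᵐ t ∂(volume.restrict (Ioi (0 : ℝ))),
              scalarL2Sq (θ t) ≤ C * Real.exp (-(γ * t)) * scalarL2Sq h) →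
        γ * Real.log (M / κ) ≤ 2 * K * M

/-- Provable now (size M: time rescaling `t ↦ t/M` in the weak formulation + bookkeeping). -/
def seisFloor_of_rmk1 : Prop := Seis2022_rmk1_L2 → SeisEnstrophyFloor

/-! ### 5. Obstruction-side typed target for the disprover of THIS crux (`_false_without_`
shape): the collinear sub-case `h ∈ ℝ · curl g` with bounded data enstrophy is refutable now on
paper (Duhamel for the vorticity, which solves the SAME scalar equation with source `curl g` at
Pr = 1, + L²-contractivity + `SeisEnstrophyFloor`). General form: sister sketch
`Cruxes/UniformRelaxationWitness/SketchIdeator1.lean`, `NoUniversalRelaxer`. -/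

/-- Planar scalar curl `∂₁g₂ − ∂₂g₁` (sketch-local; no tree-level `Torus.planarCurl` yet). -/
def planarCurl (g : 𝕋² → E²) (x : 𝕋²) : ℝ :=
  Torus.gradient (fun y => g y 1) x 0 - Torus.gradient (fun y => g y 0) x 1

/-- `RelaxingFamily` with two extra conjuncts: the profile is collinear with the curl of the force,
and the data have uniformly bounded enstrophy. -/
def RelaxingFamilyCollinear : Prop :=
  ∃ (g : 𝕋² → E²) (h : 𝕋² → ℝ), IsSmooth g ∧ IsDivFree g ∧ HasZeroMean g ∧ IsSmooth h ∧
    HasZeroMean h ∧ h ≠ 0 ∧ (∃ c : ℝ, ∀ x, h x = c * planarCurl g x) ∧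
    ∃ (ν : ℕ → ℝ) (v₀ : ℕ → 𝕋² → E²) (v : ℕ → ℝ → 𝕋² → E²),
      (∀ j, 0 < ν j) ∧ Tendsto ν atTop (𝓝 0) ∧
      (∀ j, IsGlobalLerayHopf (ν j) (fun _ => g) (v₀ j) (v j)) ∧
      (∀ j : ℕ, ∀ T : ℝ, 0 < T → MemLp (stLift (v j)) ⊤ (volume.restrict (Ioo (0 : ℝ) T ×ˢ univ))) ∧
      (∃ E : ℝ, ∀ j, meanEnergy (v j) ≤ E) ∧
      (∃ Z₀ : ENNReal, Z₀ < ⊤ ∧ ∀ j, eGradNormSq (v₀ j) ≤ Z₀) ∧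
      ∃ C γ : ℝ, 0 ≤ C ∧ 0 < γ ∧ ∀ j, DecayClause (ν j) (v j) h C γ (Ici 0)

/-- `RelaxingFamily_false_without_transversality` (paper-level, recommended to cdisprove-15009). -/
def collinear_noGo : Prop := Seis2022_rmk1_L2 → ¬ RelaxingFamilyCollinear

end Summit.AnomalousDissipation.AnomalousDissipation.Cruxes.RelaxingFamily.SketchIdeator2

end
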